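import Mathlib
import HarnessLib
import Summits.AtomisticToContinuum.HydrodynamicLimit.Theses.EulerCharacteristics

/-!
# Birth skeleton — crux `ExpSecondLaw` (stmt-AtomisticToContinuum-14608, route EulerCharacteristics)

`ExpSecondLaw` (fixed, never restated here): for local Gibbs data, `σ < σ₀(profiles)`, every flow
family, every `r ≥ 0` and `δ > 0` there is `c > 0` with, eventually in `N`,
`LG_N {S_N(z) + δ < S_N(Φ_r z)} ≤ exp(-c(N+1))`, where `S_N(Z) = ∫ ηB Z x dx` is the block
mathematical entropy (`ηB = -ρ^ℓ (3/2 log θ^ℓ - log ρ^ℓ - F(ρ^ℓ σ³))`, balls of radius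
`ℓ_N = (N+1)^(-1/4)`).

## The cut (three stubs, one occupancy floor `ρs`)

Write `S_N = S_N^{≥ρs} + R_N^{ρs}` with the FLOORED block entropy
`S_N^{≥ρs}(Z) = ∫ 1{ρs ≤ ρ^ℓ_Z(x)} ηB Z x dx` (the integrand kept only on balls whose coarse
density is at least the floor) and the sub-floor remainder `R_N^{ρs} := S_N - S_N^{≥ρs}`
(stated below literally as the difference of the two integrals). Then
`{S(z) + δ < S(Φ_r z)} ⊆ {S^{≥}(z) + δ/2 < S^{≥}(Φ_r z)} ∪ {δ/4 < R(Φ_r z)} ∪ {R(z) < -δ/4}`,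
and the crux follows from three exponential estimates by a union bound
(`ExpSecondLaw_of`, proved below; `c = min(c₁,c₂,c₃)/2`).

Layout (the in-tree skeleton convention, cf. `Cruxes/ChaosClosesEuler/Lines/Sketch.lean`): the three
registered STUBS are `theorem stub_<name> : <signature>` (admitted; signatures fully inlined over
Literature declarations); the composition principle `StubsImplyCrux := <sig₁> → <sig₂> → <sig₃> →
ExpSecondLaw` is FULLY PROVED as `stubsImplyCrux` (axioms propext / Classical.choice / Quot.sound —
the kernel certificate that nothing but the three stub statements is used); and
`theorem ExpSecondLaw_of : ExpSecondLaw := stubsImplyCrux stub_… stub_… stub_…` concludes the crux BY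
NAME modulo the stubs (the single crux-concluding theorem of the file, as the native
`#h21_check_skeleton` audit requires; it is the file a lead prover completes).

* `stub_flooredSecondLaw` — the OCCUPANCY-FLOORED exponential block second law, for every floor
  `ρs > 0`: the statement the printed static mechanism (explicit tilt `dLG/dG = e^{(N+1)Λ_N(U(0))}/𝒵`
  + Liouville invariance of `G` + static block LD under `G`, abstract form landed as
  `Theorems.measure_twoTime_rel_le_card_sq_mul`) actually addresses: above the floor every ball
  holds `≳ ρs·N^{1/4} → ∞` spheres, so the rate identity `I_G = ∫η_σ + linear(totals)` is a
  thermodynamic statement. This is the prover's typed repair `C′` of 2026-08-16 (evidence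
  `ExpSecondLawFlooredDraft.lean`, `ExpSecondLaw-static-obstruction.md` on the item).
* `stub_subfloorExcessRare` — along the flow, at time `r`, the sub-floor remainder exceeds `δ`
  only with probability `≤ e^{-c(N+1)}` once the floor is small: NO ULTRA-COLD SPARSE CLUSTERS.
  This is exactly the obstruction isolated by the prover (sparse ultra-cold pairs raise the block
  entropy by `x` at `G`-cost `Nx/2`, below the thermodynamic price `Nx`, so no static transfer
  through the time-0 tilt reaches them for `δ < h′(profiles)`): the irreducibly DYNAMICAL content
  of the crux as filed, now a named target.
* `stub_subfloorDeficitRare` — at time `0`, the sub-floor remainder is below `-δ` only with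
  probability `≤ e^{-c(N+1)}` once the floor is small: STATIC (hot or merely sparse balls;
  Jensen on the sparse mass `≤ ρs` against an exponential Cramér bound for the total kinetic
  energy under the local Gibbs law, plus `|ρ log ρ| ≤ ρs log(1/ρs)` below the floor).

Disproof used: no `Disproof.lean` exists for this crux yet (`ledger crux ls`, 2026-08-17); the
line honours the prover's static-obstruction memo instead — the tilt/invariance/static-LD
mechanism is invoked ONLY above the floor (`stub_flooredSecondLaw`), and the sub-floor freak
events it cannot price are quarantined in `stub_subfloorExcessRare`.
Negatives index (`ledger negatives --problem AtomisticToContinuum`): no stub is an instance of a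
refuted statement (the only refutation on this route, `EulerCharacteristicsExpTailBudget_refuted`,
concerns cubic VELOCITY tails of single spheres in exponential currency; every event here is an
extensive block-entropy event or carries its own small-floor quantifier).
-/

noncomputable section

namespace Summit.AtomisticToContinuum.HydrodynamicLimit.Cruxes.ExpSecondLaw.Birth

open MeasureTheory Filter Set

/-- **stub 1 — occupancy-floored exponential block second law** (`C′` of the prover's
2026-08-16 memo). For local Gibbs data, `σ < σ₀(profiles)`, all flow families, EVERY floor
`ρs > 0`, every `r ≥ 0` and `δ > 0` there is `c > 0` with, eventually in `N`,
`LG_N {S^{≥ρs}(z) + δ < S^{≥ρs}(Φ_r z)} ≤ exp(-c(N+1))`, where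
`S^{≥ρs}(Z) = ∫ 1{ρs ≤ ρ^ℓ_Z(x)} ηB Z x dx` keeps the block entropy density only on balls of
coarse density at least `ρs` (each such ball holds `≥ ρs·(4π/3)·(N+1)^{1/4} → ∞` spheres).
Why plausibly true: the printed mechanism — `dLG/dG = exp((N+1)Λ_N(U_N(0)))/𝒵` with `Λ_N`
linear in the time-0 block fields, `G` flow-invariant (`GibbsInvariance_holds`), static block-level
LD upper bound under `G` whose rate is `∫η_σ + linear(conserved totals)` ABOVE the floor, where the
entropy/cost identity is thermodynamic (`measure_twoTime_rel_le_card_sq_mul` is its abstract form).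
Size: L (static block LDP for canonical hard spheres at scale `ℓ_N`, Georgii1994 Thm 2 /
Georgii1995 Thm 3.2 nearest print; floor boundary fluctuations charged via mass).
Leans on: `Theorems.measure_twoTime_rel_le_card_sq_mul`, `GibbsInvariance_holds`,
`TransferInequality_holds` (tilt bookkeeping), `HsEosLowDensity_holds`; KipnisLandim1999 App. 1 §8,
RoeckMaesNetocny2006 Prop 3.1. -/
theorem stub_flooredSecondLaw : ∀ (a₀ θ₀ : Literature.MathematicalPhysics.KineticTheory.T3 → ℝ) (u₀ : Literature.MathematicalPhysics.KineticTheory.T3 → Literature.MathematicalPhysics.KineticTheory.V3), Continuous a₀ → Continuous θ₀ → Continuous u₀ → (∀ x, 0 < a₀ x) → (∀ x, 0 < θ₀ x) → ∃ σ₀ : ℝ, 0 < σ₀ ∧ ∀ σ : ℝ, 0 < σ → σ < σ₀ → ∀ Φ : (N : ℕ) → Literature.Analysis.FluidPDE.HardSphereFlow (Literature.Analysis.FluidPDE.Torus.geometry (Fin 3)) (Literature.MathematicalPhysics.KineticTheory.hsDiameter σ N) (N + 1), ∀ ρs : ℝ, 0 < ρs → ∀ r : ℝ, 0 ≤ r →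 ∀ δ : ℝ, 0 < δ → ∃ c : ℝ, 0 < c ∧ ∀ᶠ N : ℕ in Filter.atTop, Literature.MathematicalPhysics.KineticTheory.localGibbsLaw σ a₀ u₀ θ₀ N (Φ N) {z | (let ℓ : ℝ := ((N + 1 : ℕ) : ℝ) ^ (-(1 / 4 : ℝ)); let χ : Literature.MathematicalPhysics.KineticTheory.T3 → Literature.MathematicalPhysics.KineticTheory.T3 → ℝ := fun x y => if Literature.Analysis.FluidPDE.Torus.euclidDist x y < ℓ then (4 / 3 * Real.pi * ℓ ^ 3)⁻¹ else 0; let ηB : Literature.Analysis.FluidPDE.Config (N + 1) (Fin 3) Literature.MathematicalPhysics.KineticTheory.T3 → Literature.MathematicalPhysics.KineticTheory.T3 → ℝ := fun Z x => -(Literature.MathematicalPhysics.KineticTheory.empiricalDensityField Z (χ x) * (3 / 2 * Real.log (2 / 3 * (Literature.MathematicalPhysics.KineticTheory.empiricalEnergyField Z (χ x) / Literature.MathematicalPhysics.KineticTheory.empiricalDensityField Z (χ x) - ‖Literature.MathematicalPhysics.KineticTheory.empiricalMomentumField Z (χ x)‖ ^ 2 / (2 * Literature.MathematicalPhysics.KineticTheory.empiricalDensityField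 Z (χ x) ^ 2))) - Real.log (Literature.MathematicalPhysics.KineticTheory.empiricalDensityField Z (χ x)) - Literature.MathematicalPhysics.KineticTheory.hsExcessFreeEnergy (Literature.MathematicalPhysics.KineticTheory.empiricalDensityField Z (χ x) * σ ^ 3))); let ηF : Literature.Analysis.FluidPDE.Config (N + 1) (Fin 3) Literature.MathematicalPhysics.KineticTheory.T3 → Literature.MathematicalPhysics.KineticTheory.T3 → ℝ := fun Z x => if ρs ≤ Literature.MathematicalPhysics.KineticTheory.empiricalDensityField Z (χ x) then ηB Z x else 0; (∫ x, ηF z x) + δ < ∫ x, ηF ((Φ N).flow r z) x)} ≤ ENNReal.ofReal (Real.exp (-(c * (N + 1)))) := by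
  sorry

/-- **stub 2 — no ultra-cold sparse clusters along the flow** (sub-floor entropy EXCESS is
exponentially rare at time `r`; the dynamical piece). For local Gibbs data, `σ < σ₀(profiles)`,
all flow families, every `r ≥ 0` and `δ > 0` there is a floor scale `ρs₀ > 0` such that for every
floor `ρs ∈ (0, ρs₀)` some `c > 0` gives, eventually in `N`,
`LG_N {δ < S(Φ_r z) - S^{≥ρs}(Φ_r z)} ≤ exp(-c(N+1))` — the sub-floor remainder
`R^{ρs} = S - S^{≥ρs} = ∫ 1{ρ^ℓ < ρs} ηB` (written as the difference of the two integrals) of the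
time-`r` configuration does not exceed `δ`. Since below the floor `ρ log ρ ≤ 0` and
`ρ F(ρσ³) = O(ρs² σ³)`, the event forces `(3/2)∫_{ρ^ℓ<ρs} ρ^ℓ log⁺(1/θ^ℓ) ≳ δ`, i.e. sparse balls
of total mass `≤ ρs` with coldness `log(1/θ^ℓ) ≳ δ/ρs`: ULTRA-COLD SPARSE CLUSTERS (the prover's
"sparse ultra-cold pairs", block-entropy excess `x` at `G`-cost `Nx/2`).
Why plausibly true: under the invariant law `G` the event costs `≥ (N+1)δ/2 - o(N)` (velocity
coincidence of `k ≥ 2` spheres costs `(3/2)(k-1) log(1/θ)` against a gain `(3/2)(k/(N+1)) log(1/θ)`);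
under `LG` at time `r` it is a microscopic coincidence event whose only enemy is correlation with
the macroscopic time-0 tilt `Λ_N(U_N(0))` — believed absent, but NOT reachable statically for
`δ < 2h(LG|G)` (Hölder transfer `LG(A) ≤ ‖dLG/dG‖_p G(A)^{1/q}` gives rate `ε(δ/2 - h) + O(ε²)` only).
Why it might fail / size: open (dynamical decorrelation of a two-sphere velocity coincidence at
time `r` from the time-0 macrostate; no mixing result for hard spheres at fixed density); a
refuter's target is a flow family concentrating `LG`-mass `≫ e^{-N δ/2}` on time-`r` near-coincidences.
Leans on: `GibbsInvariance_holds`, `TransferInequality_holds` (insufficient alone), Simanyi2013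
(ergodicity, not LD), OllaVaradhanYau1993 §5. -/
theorem stub_subfloorExcessRare : ∀ (a₀ θ₀ : Literature.MathematicalPhysics.KineticTheory.T3 → ℝ) (u₀ : Literature.MathematicalPhysics.KineticTheory.T3 → Literature.MathematicalPhysics.KineticTheory.V3), Continuous a₀ → Continuous θ₀ → Continuous u₀ → (∀ x, 0 < a₀ x) → (∀ x, 0 < θ₀ x) → ∃ σ₀ : ℝ, 0 < σ₀ ∧ ∀ σ : ℝ, 0 < σ → σ < σ₀ → ∀ Φ : (N : ℕ) → Literature.Analysis.FluidPDE.HardSphereFlow (Literature.Analysis.FluidPDE.Torus.geometry (Fin 3)) (Literature.MathematicalPhysics.KineticTheory.hsDiameter σ N) (N + 1), ∀ r : ℝ, 0 ≤ r → ∀ δ : ℝ, 0 < δ → ∃ ρs₀ : ℝ, 0 < ρs₀ ∧ ∀ ρs : ℝ, 0 < ρs → ρs < ρs₀ → ∃ c : ℝ, 0 < c ∧ ∀ᶠ N : ℕ in Filter.atTop, Literature.MathematicalPhysics.KineticTheory.localGibbsLaw σ a₀ u₀ θ₀ N (Φ N) {z | (let ℓ : ℝ := ((N + 1 : ℕ)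 : ℝ) ^ (-(1 / 4 : ℝ)); let χ : Literature.MathematicalPhysics.KineticTheory.T3 → Literature.MathematicalPhysics.KineticTheory.T3 → ℝ := fun x y => if Literature.Analysis.FluidPDE.Torus.euclidDist x y < ℓ then (4 / 3 * Real.pi * ℓ ^ 3)⁻¹ else 0; let ηB : Literature.Analysis.FluidPDE.Config (N + 1) (Fin 3) Literature.MathematicalPhysics.KineticTheory.T3 → Literature.MathematicalPhysics.KineticTheory.T3 → ℝ := fun Z x => -(Literature.MathematicalPhysics.KineticTheory.empiricalDensityField Z (χ x) * (3 / 2 * Real.log (2 / 3 * (Literature.MathematicalPhysics.KineticTheory.empiricalEnergyField Z (χ x) / Literature.MathematicalPhysics.KineticTheory.empiricalDensityField Z (χ x) - ‖Literature.MathematicalPhysics.KineticTheory.empiricalMomentumField Z (χ x)‖ ^ 2 / (2 * Literature.MathematicalPhysics.KineticTheory.empiricalDensityField Z (χ x) ^ 2))) - Real.log (Literature.MathematicalPhysics.KineticTheory.empiricalDensityField Z (χ x)) - Literature.MathematicalPhysics.KineticTheory.hsExcessFreeEnergy (Literature.MathematicalPhysics.KineticTheory.empiricalDensityField Z (χ x)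 * σ ^ 3))); let ηF : Literature.Analysis.FluidPDE.Config (N + 1) (Fin 3) Literature.MathematicalPhysics.KineticTheory.T3 → Literature.MathematicalPhysics.KineticTheory.T3 → ℝ := fun Z x => if ρs ≤ Literature.MathematicalPhysics.KineticTheory.empiricalDensityField Z (χ x) then ηB Z x else 0; δ < (∫ x, ηB ((Φ N).flow r z) x) - ∫ x, ηF ((Φ N).flow r z) x)} ≤ ENNReal.ofReal (Real.exp (-(c * (N + 1)))) := by
  sorry

/-- **stub 3 — sub-floor entropy DEFICIT is exponentially rare at time 0** (static). For local
Gibbs data, `σ < σ₀(profiles)`, all flow families and every `δ > 0` there is `ρs₀ > 0` such that for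
every floor `ρs ∈ (0, ρs₀)` some `c > 0` gives, eventually in `N`,
`LG_N {S(z) - S^{≥ρs}(z) < -δ} ≤ exp(-c(N+1))`: the sub-floor remainder of the INITIAL
configuration is not below `-δ`. Negative contributions below the floor come only from
`ρ^ℓ log ρ^ℓ ≥ -ρs log(1/ρs)` (deterministic, `ρs ≤ e⁻¹`) and from hot sparse balls,
`-(3/2) ρ^ℓ log θ^ℓ ≥ -(3/2) ρ^ℓ log⁺ θ^ℓ`, and by Jensen over the sparse mass `μ_s ≤ ρs`,
`∫_{ρ^ℓ<ρs} ρ^ℓ log⁺ θ^ℓ ≤ μ_s log(1 + 2E_N/(3μ_s)) ≤ ρs log(1 + 2E_N/(3ρs))` with `E_N` the total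
kinetic energy per sphere; so the event forces `E_N > E_max(δ, ρs₀)`, an exponential Cramér event
for Maxwellian velocities under the local Gibbs law (`θ₀` continuous on the compact torus).
Why plausibly true / size: M (deterministic functional inequality over the ball decomposition with
the `Real.log` junk conventions at `ρ^ℓ = 0`, `θ^ℓ = 0`, plus the exponential kinetic-energy bound
under `localGibbsLaw` = `particleLaw Φ (canonicalDensity … (localGibbsProfile a₀ u₀ θ₀))`).
Leans on: `Literature.Analysis.FluidPDE.canonicalDensity` / `localMaxwellian` (Gaussian
exponential moments of the kinetic energy), Jensen `ConcaveOn.le_map_integral` with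
`strictConcaveOn_log_Ioi`, `hsExcessFreeEnergy ≥ 0` (`hsFreeVolume_le_one`). -/
theorem stub_subfloorDeficitRare : ∀ (a₀ θ₀ : Literature.MathematicalPhysics.KineticTheory.T3 → ℝ) (u₀ : Literature.MathematicalPhysics.KineticTheory.T3 → Literature.MathematicalPhysics.KineticTheory.V3), Continuous a₀ → Continuous θ₀ → Continuous u₀ → (∀ x, 0 < a₀ x) → (∀ x, 0 < θ₀ x) → ∃ σ₀ : ℝ, 0 < σ₀ ∧ ∀ σ : ℝ, 0 < σ → σ < σ₀ → ∀ Φ : (N : ℕ) → Literature.Analysis.FluidPDE.HardSphereFlow (Literature.Analysis.FluidPDE.Torus.geometry (Fin 3)) (Literature.MathematicalPhysics.KineticTheory.hsDiameter σ N) (N + 1), ∀ δ : ℝ, 0 < δ → ∃ ρs₀ : ℝ, 0 < ρs₀ ∧ ∀ ρs : ℝ, 0 < ρs → ρs < ρs₀ → ∃ c : ℝ, 0 < c ∧ ∀ᶠ N : ℕ in Filter.atTop, Literature.MathematicalPhysics.KineticTheory.localGibbsLaw σ a₀ u₀ θ₀ N (Φ N) {z | (let ℓ : ℝ := ((N + 1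 : ℕ) : ℝ) ^ (-(1 / 4 : ℝ)); let χ : Literature.MathematicalPhysics.KineticTheory.T3 → Literature.MathematicalPhysics.KineticTheory.T3 → ℝ := fun x y => if Literature.Analysis.FluidPDE.Torus.euclidDist x y < ℓ then (4 / 3 * Real.pi * ℓ ^ 3)⁻¹ else 0; let ηB : Literature.Analysis.FluidPDE.Config (N + 1) (Fin 3) Literature.MathematicalPhysics.KineticTheory.T3 → Literature.MathematicalPhysics.KineticTheory.T3 → ℝ := fun Z x => -(Literature.MathematicalPhysics.KineticTheory.empiricalDensityField Z (χ x) * (3 / 2 * Real.log (2 / 3 * (Literature.MathematicalPhysics.KineticTheory.empiricalEnergyField Z (χ x) / Literature.MathematicalPhysics.KineticTheory.empiricalDensityField Z (χ x) - ‖Literature.MathematicalPhysics.KineticTheory.empiricalMomentumField Z (χ x)‖ ^ 2 / (2 * Literature.MathematicalPhysics.KineticTheory.empiricalDensityField Z (χ x) ^ 2))) - Real.log (Literature.MathematicalPhysics.KineticTheory.empiricalDensityField Z (χ x)) - Literature.MathematicalPhysics.KineticTheory.hsExcessFreeEnergy (Literature.MathematicalPhysics.KineticTheory.empiricalDensityField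 Z (χ x) * σ ^ 3))); let ηF : Literature.Analysis.FluidPDE.Config (N + 1) (Fin 3) Literature.MathematicalPhysics.KineticTheory.T3 → Literature.MathematicalPhysics.KineticTheory.T3 → ℝ := fun Z x => if ρs ≤ Literature.MathematicalPhysics.KineticTheory.empiricalDensityField Z (χ x) then ηB Z x else 0; (∫ x, ηB z x) - (∫ x, ηF z x) < -δ)} ≤ ENNReal.ofReal (Real.exp (-(c * (N + 1)))) := by
  sorry

/-! ### Proof of the composition `ExpSecondLaw_of` (everything below is fully proved) -/

open Literature.MathematicalPhysics.KineticTheory in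
/-- Ball radius `ℓ_N = (N+1)^{-1/4}`. -/
def ballRadius (N : ℕ) : ℝ := ((N + 1 : ℕ) : ℝ) ^ (-(1 / 4 : ℝ))

open Literature.MathematicalPhysics.KineticTheory in
/-- The sharp ball kernel `χ_N(x, ·)` of the crux (normalised indicator of the ball of radius `ℓ_N`). -/
def ballKernel (N : ℕ) (x : T3) : T3 → ℝ :=
  fun y => if Literature.Analysis.FluidPDE.Torus.euclidDist x y < ballRadius N
    then (4 / 3 * Real.pi * ballRadius N ^ 3)⁻¹ else 0

open Literature.MathematicalPhysics.KineticTheory in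
/-- The block mathematical entropy density `ηB Z x` of the crux (same term, `let`s unfolded). -/
def etaB (σ : ℝ) (N : ℕ) (Z : Literature.Analysis.FluidPDE.Config (N + 1) (Fin 3) T3) (x : T3) : ℝ :=
  -(empiricalDensityField Z (ballKernel N x) * (3 / 2 * Real.log (2 / 3 *
    (empiricalEnergyField Z (ballKernel N x) / empiricalDensityField Z (ballKernel N x) -
      ‖empiricalMomentumField Z (ballKernel N x)‖ ^ 2 / (2 * empiricalDensityField Z (ballKernel N x) ^ 2))) -
    Real.log (empiricalDensityField Z (ballKernel N x)) -
    hsExcessFreeEnergy (empiricalDensityField Z (ballKernel N x) * σ ^ 3)))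

open Literature.MathematicalPhysics.KineticTheory in
/-- Block entropy `S_N(Z) = ∫ ηB Z x dx`. -/
def bEnt (σ : ℝ) (N : ℕ) (Z : Literature.Analysis.FluidPDE.Config (N + 1) (Fin 3) T3) : ℝ :=
  ∫ x, etaB σ N Z x

open Literature.MathematicalPhysics.KineticTheory in
/-- Floored block entropy `S_N^{≥ρs}(Z) = ∫ 1{ρs ≤ ρ^ℓ_Z(x)} ηB Z x dx`. -/
def fEnt (σ : ℝ) (N : ℕ) (ρs : ℝ) (Z : Literature.Analysis.FluidPDE.Config (N + 1) (Fin 3) T3) : ℝ :=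
  ∫ x, (if ρs ≤ empiricalDensityField Z (ballKernel N x) then etaB σ N Z x else 0)

/-- The three-way union bound in exponential currency: with `m = min cᵢ` and `(N+1) m ≥ 4`,
`e^{-c₁(N+1)} + e^{-c₂(N+1)} + e^{-c₃(N+1)} ≤ e^{-(m/2)(N+1)}`. -/
theorem ofReal_exp_three_le {m c₁ c₂ c₃ : ℝ} (hm : 0 < m) (h1 : m ≤ c₁) (h2 : m ≤ c₂)
    (h3 : m ≤ c₃) {N : ℕ} (hN : ⌈4 / m⌉₊ ≤ N) :
    ENNReal.ofReal (Real.exp (-(c₁ * (N + 1)))) + ENNReal.ofReal (Real.exp (-(c₂ * (N + 1)))) +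
        ENNReal.ofReal (Real.exp (-(c₃ * (N + 1)))) ≤
      ENNReal.ofReal (Real.exp (-(m / 2 * (N + 1)))) := by
  have hN' : (4 / m : ℝ) ≤ N := (Nat.le_ceil _).trans (by exact_mod_cast hN)
  have hNpos : (0 : ℝ) < (N : ℝ) + 1 := by positivity
  have h4 : (4 : ℝ) ≤ m * N := by
    have h := (div_le_iff₀ hm).1 hN'
    linarith
  rw [← ENNReal.ofReal_add (Real.exp_pos _).le (Real.exp_pos _).le,
    ← ENNReal.ofReal_add (by positivity) (Real.exp_pos _).le]
  apply ENNReal.ofReal_le_ofReal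
  have e1 : Real.exp (-(c₁ * (N + 1))) ≤ Real.exp (-(m * (N + 1))) :=
    Real.exp_le_exp.2 (by nlinarith)
  have e2 : Real.exp (-(c₂ * (N + 1))) ≤ Real.exp (-(m * (N + 1))) :=
    Real.exp_le_exp.2 (by nlinarith)
  have e3 : Real.exp (-(c₃ * (N + 1))) ≤ Real.exp (-(m * (N + 1))) :=
    Real.exp_le_exp.2 (by nlinarith)
  -- `a := e^{-(m/2)(N+1)}` satisfies `3a ≤ 1` and `e^{-m(N+1)} = a²`
  set a : ℝ := Real.exp (-(m / 2 * (N + 1))) with ha_def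
  have ha : 0 < a := Real.exp_pos _
  have hx : (2 : ℝ) ≤ m / 2 * (N + 1) := by nlinarith
  have hE : (3 : ℝ) ≤ Real.exp (m / 2 * (N + 1)) := by
    have := Real.add_one_le_exp (m / 2 * (N + 1))
    linarith
  have haE : a * Real.exp (m / 2 * (N + 1)) = 1 := by
    rw [ha_def, ← Real.exp_add]
    simp
  have hsq : Real.exp (-(m * (N + 1))) = a * a := by
    rw [ha_def, ← Real.exp_add]
    congr 1
    ring
  have h3a : 3 * a ≤ 1 := by nlinarith [mul_le_mul_of_nonneg_left hE ha.le]
  calc Real.exp (-(c₁ * (N + 1))) + Real.exp (-(c₂ * (N + 1))) + Real.exp (-(c₃ * (N + 1)))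
      ≤ 3 * Real.exp (-(m * (N + 1))) := by linarith
    _ = (3 * a) * a := by rw [hsq]; ring
    _ ≤ 1 * a := by gcongr
    _ = a := one_mul a

/-- The pathwise inclusion behind the union bound: if the total block entropy rises by `δ`, then
either the floored entropy rises by `δ/2`, or the time-`r` sub-floor remainder exceeds `δ/4`, or
the time-`0` sub-floor remainder is below `-δ/4`. -/
theorem badEvent_subset (σ : ℝ) (N : ℕ) (ρs δ : ℝ)
    (T : Literature.Analysis.FluidPDE.Config (N + 1) (Fin 3) Literature.MathematicalPhysics.KineticTheory.T3 →
      Literature.Analysis.FluidPDE.Config (N + 1) (Fin 3) Literature.MathematicalPhysics.KineticTheory.T3) :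
    {z | bEnt σ N z + δ < bEnt σ N (T z)} ⊆
      ({z | fEnt σ N ρs z + δ / 2 < fEnt σ N ρs (T z)} ∪
        {z | δ / 4 < bEnt σ N (T z) - fEnt σ N ρs (T z)}) ∪
      {z | bEnt σ N z - fEnt σ N ρs z < -(δ / 4)} := by
  intro z hz
  simp only [Set.mem_setOf_eq, Set.mem_union] at hz ⊢
  by_contra hcon
  push Not at hcon
  obtain ⟨⟨h1, h2⟩, h3⟩ := hcon
  linarith

/-- **Composition principle: the three stub statements imply the crux.**
`StubsImplyCrux := <sig of stub_flooredSecondLaw> → <sig of stub_subfloorExcessRare> →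
<sig of stub_subfloorDeficitRare> → ExpSecondLaw` (the three signatures inlined byte-identically, the
crux by name). Proof (`stubsImplyCrux`): union bound over the inclusion union bound over the inclusion
`badEvent_subset` at floor `ρs = min(ρs₀², ρs₀³)/2` and thresholds `δ/2, δ/4, δ/4`, rate
`c = min(c₁, c₂, c₃)/2`, eventually in `N ≥ ⌈4/min cᵢ⌉`. -/
def StubsImplyCrux : Prop :=
  (∀ (a₀ θ₀ : Literature.MathematicalPhysics.KineticTheory.T3 → ℝ) (u₀ : Literature.MathematicalPhysics.KineticTheory.T3 → Literature.MathematicalPhysics.KineticTheory.V3), Continuous a₀ → Continuous θ₀ → Continuous u₀ → (∀ x, 0 < a₀ x) → (∀ x, 0 < θ₀ x) → ∃ σ₀ : ℝ, 0 < σ₀ ∧ ∀ σ : ℝ, 0 < σ → σ < σ₀ → ∀ Φ : (N : ℕ) → Literature.Analysis.FluidPDE.HardSphereFlow (Literature.Analysis.FluidPDE.Torus.geometry (Fin 3)) (Literature.MathematicalPhysics.KineticTheory.hsDiameter σ N) (N + 1), ∀ ρs : ℝ, 0 < ρs → ∀ r : ℝ, 0 ≤ r → ∀ δ : ℝ, 0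 < δ → ∃ c : ℝ, 0 < c ∧ ∀ᶠ N : ℕ in Filter.atTop, Literature.MathematicalPhysics.KineticTheory.localGibbsLaw σ a₀ u₀ θ₀ N (Φ N) {z | (let ℓ : ℝ := ((N + 1 : ℕ) : ℝ) ^ (-(1 / 4 : ℝ)); let χ : Literature.MathematicalPhysics.KineticTheory.T3 → Literature.MathematicalPhysics.KineticTheory.T3 → ℝ := fun x y => if Literature.Analysis.FluidPDE.Torus.euclidDist x y < ℓ then (4 / 3 * Real.pi * ℓ ^ 3)⁻¹ else 0; let ηB : Literature.Analysis.FluidPDE.Config (N + 1) (Fin 3) Literature.MathematicalPhysics.KineticTheory.T3 → Literature.MathematicalPhysics.KineticTheory.T3 → ℝ := fun Z x => -(Literature.MathematicalPhysics.KineticTheory.empiricalDensityField Z (χ x) * (3 / 2 * Real.log (2 / 3 * (Literature.MathematicalPhysics.KineticTheory.empiricalEnergyField Z (χ x) / Literature.MathematicalPhysics.KineticTheory.empiricalDensityField Z (χ x) - ‖Literature.MathematicalPhysics.KineticTheory.empiricalMomentumField Z (χ x)‖ ^ 2 / (2 * Literature.MathematicalPhysics.KineticTheory.empiricalDensityField Z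 (χ x) ^ 2))) - Real.log (Literature.MathematicalPhysics.KineticTheory.empiricalDensityField Z (χ x)) - Literature.MathematicalPhysics.KineticTheory.hsExcessFreeEnergy (Literature.MathematicalPhysics.KineticTheory.empiricalDensityField Z (χ x) * σ ^ 3))); let ηF : Literature.Analysis.FluidPDE.Config (N + 1) (Fin 3) Literature.MathematicalPhysics.KineticTheory.T3 → Literature.MathematicalPhysics.KineticTheory.T3 → ℝ := fun Z x => if ρs ≤ Literature.MathematicalPhysics.KineticTheory.empiricalDensityField Z (χ x) then ηB Z x else 0; (∫ x, ηF z x) + δ < ∫ x, ηF ((Φ N).flow r z) x)} ≤ ENNReal.ofReal (Real.exp (-(c * (N + 1))))) →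
  (∀ (a₀ θ₀ : Literature.MathematicalPhysics.KineticTheory.T3 → ℝ) (u₀ : Literature.MathematicalPhysics.KineticTheory.T3 → Literature.MathematicalPhysics.KineticTheory.V3), Continuous a₀ → Continuous θ₀ → Continuous u₀ → (∀ x, 0 < a₀ x) → (∀ x, 0 < θ₀ x) → ∃ σ₀ : ℝ, 0 < σ₀ ∧ ∀ σ : ℝ, 0 < σ → σ < σ₀ → ∀ Φ : (N : ℕ) → Literature.Analysis.FluidPDE.HardSphereFlow (Literature.Analysis.FluidPDE.Torus.geometry (Fin 3)) (Literature.MathematicalPhysics.KineticTheory.hsDiameter σ N) (N + 1), ∀ r : ℝ, 0 ≤ r → ∀ δ : ℝ, 0 < δ → ∃ ρs₀ : ℝ, 0 < ρs₀ ∧ ∀ ρs : ℝ, 0 < ρs → ρs < ρs₀ → ∃ c : ℝ, 0 < c ∧ ∀ᶠ N : ℕ in Filter.atTop, Literature.MathematicalPhysics.KineticTheory.localGibbsLaw σ a₀ u₀ θ₀ N (Φ N) {z | (let ℓ : ℝ := ((N + 1 : ℕ) : ℝ) ^ (-(1 / 4 : ℝ)); let χ : Literature.MathematicalPhysics.KineticTheory.T3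 → Literature.MathematicalPhysics.KineticTheory.T3 → ℝ := fun x y => if Literature.Analysis.FluidPDE.Torus.euclidDist x y < ℓ then (4 / 3 * Real.pi * ℓ ^ 3)⁻¹ else 0; let ηB : Literature.Analysis.FluidPDE.Config (N + 1) (Fin 3) Literature.MathematicalPhysics.KineticTheory.T3 → Literature.MathematicalPhysics.KineticTheory.T3 → ℝ := fun Z x => -(Literature.MathematicalPhysics.KineticTheory.empiricalDensityField Z (χ x) * (3 / 2 * Real.log (2 / 3 * (Literature.MathematicalPhysics.KineticTheory.empiricalEnergyField Z (χ x) / Literature.MathematicalPhysics.KineticTheory.empiricalDensityField Z (χ x) - ‖Literature.MathematicalPhysics.KineticTheory.empiricalMomentumField Z (χ x)‖ ^ 2 / (2 * Literature.MathematicalPhysics.KineticTheory.empiricalDensityField Z (χ x) ^ 2))) - Real.log (Literature.MathematicalPhysics.KineticTheory.empiricalDensityField Z (χ x)) - Literature.MathematicalPhysics.KineticTheory.hsExcessFreeEnergy (Literature.MathematicalPhysics.KineticTheory.empiricalDensityField Z (χ x) * σ ^ 3))); let ηF : Literature.Analysis.FluidPDE.Config (N + 1) (Fin 3) Literature.MathematicalPhysics.KineticTheory.T3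 → Literature.MathematicalPhysics.KineticTheory.T3 → ℝ := fun Z x => if ρs ≤ Literature.MathematicalPhysics.KineticTheory.empiricalDensityField Z (χ x) then ηB Z x else 0; δ < (∫ x, ηB ((Φ N).flow r z) x) - ∫ x, ηF ((Φ N).flow r z) x)} ≤ ENNReal.ofReal (Real.exp (-(c * (N + 1))))) →
  (∀ (a₀ θ₀ : Literature.MathematicalPhysics.KineticTheory.T3 → ℝ) (u₀ : Literature.MathematicalPhysics.KineticTheory.T3 → Literature.MathematicalPhysics.KineticTheory.V3), Continuous a₀ → Continuous θ₀ → Continuous u₀ → (∀ x, 0 < a₀ x) → (∀ x, 0 < θ₀ x) → ∃ σ₀ : ℝ, 0 < σ₀ ∧ ∀ σ : ℝ, 0 < σ → σ < σ₀ → ∀ Φ : (N : ℕ) → Literature.Analysis.FluidPDE.HardSphereFlow (Literature.Analysis.FluidPDE.Torus.geometry (Fin 3)) (Literature.MathematicalPhysics.KineticTheory.hsDiameter σ N) (N + 1), ∀ δ : ℝ, 0 < δ → ∃ ρs₀ : ℝ, 0 < ρs₀ ∧ ∀ ρs : ℝ, 0 < ρs → ρs < ρs₀ → ∃ c : ℝ,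 0 < c ∧ ∀ᶠ N : ℕ in Filter.atTop, Literature.MathematicalPhysics.KineticTheory.localGibbsLaw σ a₀ u₀ θ₀ N (Φ N) {z | (let ℓ : ℝ := ((N + 1 : ℕ) : ℝ) ^ (-(1 / 4 : ℝ)); let χ : Literature.MathematicalPhysics.KineticTheory.T3 → Literature.MathematicalPhysics.KineticTheory.T3 → ℝ := fun x y => if Literature.Analysis.FluidPDE.Torus.euclidDist x y < ℓ then (4 / 3 * Real.pi * ℓ ^ 3)⁻¹ else 0; let ηB : Literature.Analysis.FluidPDE.Config (N + 1) (Fin 3) Literature.MathematicalPhysics.KineticTheory.T3 → Literature.MathematicalPhysics.KineticTheory.T3 → ℝ := fun Z x => -(Literature.MathematicalPhysics.KineticTheory.empiricalDensityField Z (χ x) * (3 / 2 * Real.log (2 / 3 * (Literature.MathematicalPhysics.KineticTheory.empiricalEnergyField Z (χ x) / Literature.MathematicalPhysics.KineticTheory.empiricalDensityField Z (χ x) - ‖Literature.MathematicalPhysics.KineticTheory.empiricalMomentumField Z (χ x)‖ ^ 2 / (2 * Literature.MathematicalPhysics.KineticTheory.empiricalDensityField Z (χ x) ^ 2))) - Real.log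 (Literature.MathematicalPhysics.KineticTheory.empiricalDensityField Z (χ x)) - Literature.MathematicalPhysics.KineticTheory.hsExcessFreeEnergy (Literature.MathematicalPhysics.KineticTheory.empiricalDensityField Z (χ x) * σ ^ 3))); let ηF : Literature.Analysis.FluidPDE.Config (N + 1) (Fin 3) Literature.MathematicalPhysics.KineticTheory.T3 → Literature.MathematicalPhysics.KineticTheory.T3 → ℝ := fun Z x => if ρs ≤ Literature.MathematicalPhysics.KineticTheory.empiricalDensityField Z (χ x) then ηB Z x else 0; (∫ x, ηB z x) - (∫ x, ηF z x) < -δ)} ≤ ENNReal.ofReal (Real.exp (-(c * (N + 1))))) →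
  Summit.AtomisticToContinuum.HydrodynamicLimit.Theses.EulerCharacteristics.ExpSecondLaw

/-- `StubsImplyCrux` holds — the composition, fully proved (no admitted step in its cone). -/
theorem stubsImplyCrux : StubsImplyCrux := by
  delta StubsImplyCrux
  intro h1 h2 h3 a₀ θ₀ u₀ ha hθ hu hap hθp
  obtain ⟨σ₁, hσ₁, H1⟩ := h1 a₀ θ₀ u₀ ha hθ hu hap hθp
  obtain ⟨σ₂, hσ₂, H2⟩ := h2 a₀ θ₀ u₀ ha hθ hu hap hθp
  obtain ⟨σ₃, hσ₃, H3⟩ := h3 a₀ θ₀ u₀ ha hθ hu hap hθp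
  refine ⟨min σ₁ (min σ₂ σ₃), lt_min hσ₁ (lt_min hσ₂ hσ₃), ?_⟩
  intro σ hσ hσlt Φ r hr δ hδ
  have hσ1 : σ < σ₁ := lt_of_lt_of_le hσlt (min_le_left _ _)
  have hσ2 : σ < σ₂ := lt_of_lt_of_le hσlt ((min_le_right _ _).trans (min_le_left _ _))
  have hσ3 : σ < σ₃ := lt_of_lt_of_le hσlt ((min_le_right _ _).trans (min_le_right _ _))
  obtain ⟨ρa, hρa, H2'⟩ := H2 σ hσ hσ2 Φ r hr (δ / 4) (by positivity)
  obtain ⟨ρb, hρb, H3'⟩ := H3 σ hσ hσ3 Φ (δ / 4) (by positivity)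
  have hmin : 0 < min ρa ρb := lt_min hρa hρb
  set ρs : ℝ := min ρa ρb / 2 with hρs_def
  have hρs : 0 < ρs := by positivity
  have hρsa : ρs < ρa := by
    have := min_le_left ρa ρb
    rw [hρs_def]; linarith
  have hρsb : ρs < ρb := by
    have := min_le_right ρa ρb
    rw [hρs_def]; linarith
  obtain ⟨c₁, hc₁, E1⟩ := H1 σ hσ hσ1 Φ ρs hρs r hr (δ / 2) (by positivity)
  obtain ⟨c₂, hc₂, E2⟩ := H2' ρs hρs hρsa
  obtain ⟨c₃, hc₃, E3⟩ := H3' ρs hρs hρsb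
  have hm : 0 < min c₁ (min c₂ c₃) := lt_min hc₁ (lt_min hc₂ hc₃)
  refine ⟨min c₁ (min c₂ c₃) / 2, by positivity, ?_⟩
  filter_upwards [E1, E2, E3, Filter.eventually_ge_atTop ⌈4 / min c₁ (min c₂ c₃)⌉₊] with N e1 e2 e3 hN
  -- restate the three estimates and the goal through the named functionals (definitional)
  change Literature.MathematicalPhysics.KineticTheory.localGibbsLaw σ a₀ u₀ θ₀ N (Φ N)
      {z | fEnt σ N ρs z + δ / 2 < fEnt σ N ρs ((Φ N).flow r z)} ≤
    ENNReal.ofReal (Real.exp (-(c₁ * (N + 1)))) at e1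
  change Literature.MathematicalPhysics.KineticTheory.localGibbsLaw σ a₀ u₀ θ₀ N (Φ N)
      {z | δ / 4 < bEnt σ N ((Φ N).flow r z) - fEnt σ N ρs ((Φ N).flow r z)} ≤
    ENNReal.ofReal (Real.exp (-(c₂ * (N + 1)))) at e2
  change Literature.MathematicalPhysics.KineticTheory.localGibbsLaw σ a₀ u₀ θ₀ N (Φ N)
      {z | bEnt σ N z - fEnt σ N ρs z < -(δ / 4)} ≤
    ENNReal.ofReal (Real.exp (-(c₃ * (N + 1)))) at e3
  change Literature.MathematicalPhysics.KineticTheory.localGibbsLaw σ a₀ u₀ θ₀ N (Φ N)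
      {z | bEnt σ N z + δ < bEnt σ N ((Φ N).flow r z)} ≤
    ENNReal.ofReal (Real.exp (-(min c₁ (min c₂ c₃) / 2 * (N + 1))))
  calc Literature.MathematicalPhysics.KineticTheory.localGibbsLaw σ a₀ u₀ θ₀ N (Φ N)
        {z | bEnt σ N z + δ < bEnt σ N ((Φ N).flow r z)}
      ≤ Literature.MathematicalPhysics.KineticTheory.localGibbsLaw σ a₀ u₀ θ₀ N (Φ N)
          (({z | fEnt σ N ρs z + δ / 2 < fEnt σ N ρs ((Φ N).flow r z)} ∪
            {z | δ / 4 < bEnt σ N ((Φ N).flow r z) - fEnt σ N ρs ((Φ N).flow r z)}) ∪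
          {z | bEnt σ N z - fEnt σ N ρs z < -(δ / 4)}) :=
        measure_mono (badEvent_subset σ N ρs δ ((Φ N).flow r))
    _ ≤ Literature.MathematicalPhysics.KineticTheory.localGibbsLaw σ a₀ u₀ θ₀ N (Φ N)
          ({z | fEnt σ N ρs z + δ / 2 < fEnt σ N ρs ((Φ N).flow r z)} ∪
            {z | δ / 4 < bEnt σ N ((Φ N).flow r z) - fEnt σ N ρs ((Φ N).flow r z)}) +
        Literature.MathematicalPhysics.KineticTheory.localGibbsLaw σ a₀ u₀ θ₀ N (Φ N)
          {z | bEnt σ N z - fEnt σ N ρs z < -(δ / 4)} := measure_union_le _ _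
    _ ≤ Literature.MathematicalPhysics.KineticTheory.localGibbsLaw σ a₀ u₀ θ₀ N (Φ N)
          {z | fEnt σ N ρs z + δ / 2 < fEnt σ N ρs ((Φ N).flow r z)} +
        Literature.MathematicalPhysics.KineticTheory.localGibbsLaw σ a₀ u₀ θ₀ N (Φ N)
          {z | δ / 4 < bEnt σ N ((Φ N).flow r z) - fEnt σ N ρs ((Φ N).flow r z)} +
        Literature.MathematicalPhysics.KineticTheory.localGibbsLaw σ a₀ u₀ θ₀ N (Φ N)
          {z | bEnt σ N z - fEnt σ N ρs z < -(δ / 4)} :=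
        add_le_add (measure_union_le _ _) le_rfl
    _ ≤ ENNReal.ofReal (Real.exp (-(c₁ * (N + 1)))) + ENNReal.ofReal (Real.exp (-(c₂ * (N + 1)))) +
        ENNReal.ofReal (Real.exp (-(c₃ * (N + 1)))) := add_le_add (add_le_add e1 e2) e3
    _ ≤ ENNReal.ofReal (Real.exp (-(min c₁ (min c₂ c₃) / 2 * (N + 1)))) :=
        ofReal_exp_three_le hm (min_le_left _ _) ((min_le_right _ _).trans (min_le_left _ _))
          ((min_le_right _ _).trans (min_le_right _ _)) hN


/-- **The crux modulo the stubs** — `ExpSecondLaw` BY NAME from the three registered stubs through the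
fully proved composition `stubsImplyCrux`; a complete proof the moment the three stubs land. -/
theorem ExpSecondLaw_of : Summit.AtomisticToContinuum.HydrodynamicLimit.Theses.EulerCharacteristics.ExpSecondLaw :=
  stubsImplyCrux stub_flooredSecondLaw stub_subfloorExcessRare stub_subfloorDeficitRare

end Summit.AtomisticToContinuum.HydrodynamicLimit.Cruxes.ExpSecondLaw.Birth
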